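import Summits.BirchSwinnertonDyer.BirchSwinnertonDyer.Theorems.ErratumRoadFiveBdvCalibrationSplitRDefs
import Literature.NumberTheory.EllipticCurves.NewformGaloisRep
import Literature.NumberTheory.GaloisRepresentations.ResidualGaloisRep
import HarnessLib

/-!
# The BDV-calibration split of `A♭-fam` — NEWFORM-SHAPED calibrator `S2-NF` ON THE AMENDED EXPONENT R: Defs (vocabulary)
# (crux stmt-BirchSwinnertonDyer-19715, (α2) item stmt-BirchSwinnertonDyer-33169 `ErratumRoadFive.KatoValuationIneqNonsplitAtFive`;
# deliverable (622)(1) of idea-9 g49–g51, PORTED — d2R P2)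

This is the BUILT port (LEAD `bsd-line-er5-p1` g20; pen words `d2land-nf` 2026-08-31T02:35:43Z → `d2R` 03:03:23Z, P2 gate met
03:30:54Z; ONE-CONSTANT RULE 03:20:23Z) of the crux WORKFILE
`Cruxes/EulerHalfNotRamNoInertSetAtFive/Lines/bdv_calibration_split_nf_Sketch.lean` rev 1.2.1 (commit 1a3edf267b08, 950 l., sha16 402b542340c4b640; critic idea-crit-14 V381 PASS on rev 1.2, rev 1.2.1 = docstring-only touch-up paying V381 N1–N4; FROZEN for d2R),
split into three modules by the tree's 400-line cap: THIS file (§0 the curve conjunct ON R at a given shift `V` + §1 the newform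
D-twins + the posited two-field interface `NFPort`), `ErratumRoadFiveBdvCalibrationSplitNFCalibratorDefs` (§2 the S2-NF binder
`NFCalibratorDatum` (+`rhs`, `rhsCanonical`), §3–§5 the statements S1-NF-on-R ∕ S2-NF, the finer split and the `∃ P`-bundled
registrable texts) and `ErratumRoadFiveBdvCalibrationSplitNF` (the PROVED recompositions to `AFlatFamStatementR`).
ONE-CONSTANT RULE (pen 03:20:23Z, critic V381 N1): the R curve vocabulary — `bdvExplicitExponentR`(+`_of_not_split`),
`BdvChainExplicitNonsplitR`, `EisensteinPeriodRatioValuationR`, `AFlatFamStatementR` — is declared ONCE, in the d2R-P1 module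
`ErratumRoadFiveBdvCalibrationSplitRDefs` (p806950), and IMPORTED here, as is the d1land curve vocabulary (`bottomClass`,
`NonExceptionalRankOneAt`(+lemma), `bdvExplicitExponent`(+`_of_not_split`), p782094); the workfile's local copies of these are
porting aids and are NOT ported (their identity with the imported constants is the P2 bind probe of the mirror).  Everything
else is the workfile's text 1:1 (same names, same binder order, same bodies): the only changes are the namespace, `@[conjecture]`
on the open statements (cell RULING 75), pruned imports (no route file), and §-comments re-pointed to the sibling modules.
Companion memos: `Lines/bdv22_S2NF_typing.md`, `Lines/bdv22_o4_erho_level.md` rev 1.4, typer `pub/bsd-stepL/ty-snf/g1/T0PRIME-MEMO.md`.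

NOTHING here proves a summit statement; typed ≠ proved; BSD is proved for no curve.  Workfile docstring §A–§C follow verbatim
(§D–§G in `…NFCalibratorDefs`, §H in `…NF`).

## A. Currency decision (why S2-NF is SHORTER than S2)

BSTW work in the newform's OPTIMAL currency [BSTW24 = arXiv:2409.01350v1, §1.2 p.13 L40–p.14 L160: good `ω ∈ S_{g,O}`,
`O`-bases `γ_g^± = δ_g^±/c̃_g` of `T^±_{O,g}` [Lemma 1.5 (ii) p.15 L21–31; rev 1.1 wrote «`γ^± = δ_g^±`» — e10, corrected
§H], optimal periods `Ω^±`, Rem. 1.3 p.14 L133: «for the newform of an elliptic curve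
the optimal periods are a `ℤ_(p)`-basis of the Néron periods»].  In that currency the three CONVERSION terms of the
registered curve exponent `bdvExplicitExponent` — Manin `ord_p c`, the lattice index `ord_p k`, and
`Γ₀ = ord_p r_f − ord_p m_f` — are ABSENT, and `perRatio = 1` — under the PORT PINNING fixed in §H (rev 1.2: not «identically»; the NF chain's own
index, BSTW's `Γ₁(N)`-congruence number `c̃_g`, sits in the class normalisation and is NAMED there).  What is left of the exponent is read off
BSTW (log-Kato-elt-1) [p.60 L17–24] ∘ (GRL=logheegner)(i) [p.60 L8–12] ∘ BDP:
`‖X′‖ = p · ‖p + 1 − a_p(g)‖_λ · ‖s′‖_λ · ‖σ′‖ / ‖q′ · R′ · ∏_{ℓ ∣ A, ℓ ≠ p} E′_ℓ‖_λ`      (NF crossing identity, NORM FORM)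
with `√|d_L| · L(g ⊗ χ_L, 1) = s′ · Ω⁻` (`‖𝔤(χ_L)‖_λ = 1` as `p ∤ d_L`), `σ′ = log_BK^{η_ω}(loc_p z)` for the bottom class
`z` of a Kato family pinned by the VALUE LAW in `(Ω⁺, Ω⁻)`-currency with constant `q′` and auxiliary cusp data
`(c, d₁, a, A, d′)` (so `σ′` differs from BSTW's `log_BK(loc_p z_Kato(g))` by `q′ R′ ∏ E′_ℓ`, exactly as `σ` differs on the
curve side by `q R ∏ P_ℓ / perRatio`), and `u_L, c(ω,γ,γ′) ∈ O_λ^×` [p.60 L76–96 (`u_L ∈ ℤ_(p)^×`); Prop. (ERLIint)].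
COEFFICIENTS: `ℚ̄_p`-currency of the tree — the place `λ ∣ p` of the Hecke field is the one induced by the frame's
`ι′ : PadicAlgCl p ≃+* ℂ`, `‖·‖_λ := ‖ι′⁻¹(·)‖` on `PadicAlgCl p` (Mathlib spectral norm; handles ramified `λ` with no
bookkeeping), so NO valuation twin (D5) and NO coefficient-field binder is needed: D5 = `‖ι′.symm ·‖`.

## B. The D-twins (all ELABORATE; D1 is a CITATION, D3 is the ONE posited interface)

* D1 (Galois lattice ↔ `tateRep W p`): CITED, not restated — `IsGaloisRepOfNewform1 (liftToGamma1 N 2 g) ι_λ {ℓ ∣ Np} ρ`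
  (`NewformGaloisRep.lean`) for `ρ : FramedGaloisRep ℚ (PadicAlgCl p) 2`, `ι_λ = ι′⁻¹ ∘ (K_g ⊂ ℂ)`; arithmetic-Frobenius
  charpoly `X² − a_ℓ X + ℓ` = the Tate-module (homological, `V_g(1)`) normalisation of `tateRep`; residual irreducibility
  `ρ.IsResiduallyAbsIrreducible` (`ResidualGaloisRep.lean`) twins `Irr W p`/`Surj W p`.
* D2 (Kato family ↔ `ZetaBody W p f …`): `ZetaBodyNF` (§1) = `ZetaBody` transcribed clause by clause (C1–C5) over
  `T := ρ.toGaloisRep` (generic `IsEulerSystem`/`H1`/`resLe`/`conjMap` of `EulerSystem.lean`), value datum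
  `Λ_{k,r} : H¹ → ℚ̄_p ⊗_ℚ ℚ(ζ_m)`, periods `(Ω⁺, Ω⁻)` as PARAMETERS pinned by `IsOptimalPeriodPair` (D2p), cusp factor
  `cuspFactorNF` (D2c: symbols `plusSymbol g r / Ω⁺`, `minusSymbol g r / Ω⁻` instead of the RATIONAL `ratPlusSymbol f`),
  Euler factor `eulerFactorAtOneNF` (D2e: `cuspCoeff g ℓ` instead of `W.LFunction ℓ`).  [Kato04 Thm. 12.5 is stated for
  general newforms with coefficients; (8.1.3), Prop. 8.12, Thm. 9.7, Thm. 6.6 (1) likewise.]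
* D3 (Bloch–Kato/Kummer log ↔ `HasLocPKummerLog W p x σ`): the tree's version is the FORMAL-GROUP log of `W` at `p`;
  a newform has no curve, so `log_BK^{η_ω} ∘ loc_p` on `H¹(ℚ(μ_m), V_g(1))` [BSTW §1.2.10–1.2.12 p.16–18 (Coleman map,
  `η_ω`)] is posited as the single field `NFPort.HasBKLog` of an INTERFACE `NFPort` (a `structure`, never an instance,
  never an axiom): every statement (sibling module) takes `(P : NFPort)`; the CONSTRUCTION «the intended `P` exists» is port debt
  for the typer (Literature module on `D_dR`/`exp_BK` for `V_g`), stated separately, never smuggled.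
* D4 (Heegner side ↔ `ModularParametrizationData`/`heegnerPointComplex`/`Dt.c`/`modularDegree`/`congruenceNumber`):
  ABSENT in optimal currency — the BDP value `X′` is read through the form-typed `IsBDPLFunction ι′ 𝔭 κ γ′ g ΩK Ωp Λg`
  (already newform-level in the tree) and BSTW's (GRL=logheegner) carries `log_{ω_g} y_L` internally.
* D5 (valuations ↔ `padicValRat`/`σ.valuation`): `‖ι′.symm ·‖` (§A).

## C. Curve-typed decls of the registered frame and their newform twins (decl ↦ twin)

`tateRep W p` ↦ `ρ.toGaloisRep` + `IsGaloisRepOfNewform1` (cite) · `Irr W p`, `Surj W p` ↦ `ρ.IsResiduallyAbsIrreducible` ·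
`GoodOrd W p` ↦ `¬ p ∣ 2N ∧ ‖ι′⁻¹ a_p(g)‖ = 1` · `W.analyticRank = 1` ↦ `∃ Λ ∈ completedCuspFormLContinuations N g,
analyticOrderNatAt Λ 1 = 1` · `(W.quadraticTwist d_L).entireLFunction 1 ≠ 0` ↦ `∃` entire continuation of
`twistedLSeries g χ_L` non-vanishing at `1`, `χ_L` pinned by `jacobiSym d_L` (tree idiom) · `ZetaBody` ↦ `ZetaBodyNF` ·
`ratCuspFactor f`/`cuspFactor f` ↦ `cuspFactorNF` · `eulerFactorAtOne W` ↦ `eulerFactorAtOneNF` · `plusPeriod f`,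
`minusPeriod f`, `perRatio`, `W.realPeriodRat`, `W.imaginaryPeriodRat` ↦ `IsOptimalPeriodPair g ι′ Ω⁺ Ω⁻` ·
`IwasawaH1Data`/`levelToLayer`/`bottomClass`/`y` ↦ NOT NEEDED (the bottom class is the level-`(0, ∅)` member `z 0 1` of
the family itself; the Iwasawa detour exists on the curve side for the main-conjecture currency of the LEAD, not for the
crossing identity) · `HasLocPKummerLog W p` ↦ `P.HasBKLog` (D3, posited) · `ModularParametrizationData`, `HeegnerDatum`,
`heegnerPointComplex`, `Dt.c`, `modularDegree`, `congruenceNumber`, `s`, `k` ↦ ABSENT except `s′` (§A) ·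
`IsBDPLFunction … Dt.f …`, `Λf.HasValueAt 0 X`, `X11b.primeOfEmbeddingDatum` ↦ THEMSELVES (form- or `L`-typed already) ·
`padicVal*`, `σ.valuation` ↦ norms `‖ι′.symm ·‖`, `‖σ′‖`.
-/

set_option autoImplicit false
-- D-0017: single-problem summit, so `Summit.BirchSwinnertonDyer.BirchSwinnertonDyer.…` repeats a namespace BY DESIGN.
set_option linter.dupNamespace false

noncomputable section

open scoped Classical NumberField TensorProduct BigOperators Pointwise

namespace Summit.BirchSwinnertonDyer.BirchSwinnertonDyer.Theorems.ErratumRoadFiveBdvCalibrationSplitNF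

open Field
open Literature.NumberTheory.GaloisRepresentations
open Literature.NumberTheory.EllipticCurves Literature.NumberTheory.EllipticCurves.Kato2004
open Literature.NumberTheory.EllipticCurves.Kato2004.EulerSystemValues
open Literature.NumberTheory.EllipticCurves.Rank1Residual
open Literature.NumberTheory.EllipticCurves.Rank1Residual.Typed
open Literature.NumberTheory.EllipticCurves.ModularForms
open Literature.NumberTheory.EllipticCurves.Castella2018
open Summit.BirchSwinnertonDyer.Rank1Residual
open Summit.BirchSwinnertonDyer.BirchSwinnertonDyer.Theorems.ErratumRoadFiveBdvCalibrationSplit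
open Summit.BirchSwinnertonDyer.BirchSwinnertonDyer.Theorems.ErratumRoadFiveBdvCalibrationSplitR
open IsDedekindDomain (HeightOneSpectrum)
open CongruenceSubgroup (Gamma0)
open Rat.HeightOneSpectrum (primesEquiv)

/-! ## §0 Curve side ON R — the S1 conjunct at a given shift `V` (the rest of the curve vocabulary, registered and
amended, is IMPORTED from `ErratumRoadFiveBdvCalibrationSplitDefs` ∕ `ErratumRoadFiveBdvCalibrationSplitRDefs`) -/

/-- The CURVE conjunct of S1 ON THE R EXPONENT at a given shift function `V` (rev 1.2 §H (H1)) = deliverable 1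
`BdvChainExplicitNonsplit` l.234–297 with the leading `∃ V : ℕ → ℤ → ℤ,` removed and `bdvExplicitExponent … v` replaced by
`bdvExplicitExponentR … v N` (`N` the level binder of `f`; verbatim otherwise).  `BdvChainExplicitNonsplitR ↔ ∃ V, BdvChainCurveConjunctR V` is `Iff.rfl` (certified in `ErratumRoadFiveBdvCalibrationSplitNF`); the exponent is the IMPORTED `ErratumRoadFiveBdvCalibrationSplitR.bdvExplicitExponentR`.
[cite: BertoliniDarmonVenerucci2022, §4 (38) and Lemma 4.6, p. 44–45] [cite: KingsLoefflerZerbes2017, Thm. 10.2.2, p. 79–80] -/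
def BdvChainCurveConjunctR (V : ℕ → ℤ → ℤ) : Prop :=
    ∀ (W : WeierstrassCurve ℚ) [W.IsElliptic] [W.IsGloballyMinimal] (p : ℕ) [Fact p.Prime]
      [ContinuousSMul ℤ_[p] (W.tateModule p)] [Module.Free ℤ_[p] (W.tateModule p)]
      [Module.Finite ℤ_[p] (W.tateModule p)] [NeZero (W.conductorNorm ℤ)],
      NonExceptionalRankOneAt W p → 5 ≤ p → Surj W p →
      ∀ (L : Type) [Field L] [NumberField L], IsImaginaryQuadratic L →
        SatisfiesHeegnerHypothesis (W.conductorNorm ℤ) L → SatisfiesHeegnerHypothesis p L →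
        NumberField.discr L < -4 → Odd (NumberField.discr L) →
        (W.quadraticTwist (NumberField.discr L : ℚ)).entireLFunction 1 ≠ 0 →
      ∀ (Dt : ModularParametrizationData W (W.conductorNorm ℤ))
        (Hd : HeegnerDatum (W.conductorNorm ℤ) (NumberField.discr L)) (w₀ : NumberField.InfinitePlace L)
        (PL : (W.baseChange L).toAffine.Point),
        WeierstrassCurve.Affine.Point.map w₀.embedding.toRatAlgHom PL = heegnerPointComplex Dt Hd →
        ¬ (p : ℤ) ∣ Dt.c →
      ∀ (s : ℚ) (k : ℤ),
        (Real.sqrt ((NumberField.discr L).natAbs : ℝ) : ℂ) *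
            (W.quadraticTwist (NumberField.discr L : ℚ)).entireLFunction 1 = (s : ℂ) * (minusPeriod Dt.f : ℂ) →
        (Dt.c : ℝ) * minusPeriod Dt.f = k * W.imaginaryPeriodRat →
      ∀ (W' : WeierstrassCurve ℚ) [W'.IsElliptic] (D : ModularParametrizationData W' (W.conductorNorm ℤ)),
        D.f = Dt.f →
        (∀ (W'' : WeierstrassCurve ℚ) [W''.IsElliptic] (D'' : ModularParametrizationData W'' (W.conductorNorm ℤ)),
            D''.f = D.f → D.modularDegree ≤ D''.modularDegree) →
      ∀ (K : ZpExtension ℚ p) (hK : K.IsCyclotomic) (γ : absoluteGaloisGroup ℚ)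
        (I : IwasawaH1Data W p K γ), K.IsTopGenerator γ →
      ∀ (hp : p ≠ 2) (N : ℕ) [NeZero N] (f : CuspForm (Gamma0 N) 2), IsNewformOf W f →
      ∀ (ι : (n : ℕ) → (CyclotomicField n ℚ →+* ℂ)) (q : ℚ)
        (Λ : ∀ (m : ℕ) (r : Finset (HeightOneSpectrum (𝓞 ℚ))),
          H1 (tateRep W p) (cycSubgroup p m r) →ₗ[ℤ_[p]] ℚ_[p] ⊗[ℚ] CyclotomicField (cycLevel p m r) ℚ)
        (c d₁ a : ℤ) (A : ℕ) (d' : ℤ)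
        (z : ∀ (m : ℕ) (r : (cyclotomicLevelsRat p (badPlaces c d₁ A N)).Ideals),
          H1 (tateRep W p) ((cyclotomicLevelsRat p (badPlaces c d₁ A N)).level m r.1))
        (x : ∀ (m : ℕ) (r : (cyclotomicLevelsRat p (badPlaces c d₁ A N)).Ideals),
          CyclotomicField (cycLevel p m r.1) ℚ)
        (y : I.H) (perRatio : ℚ),
        q ≠ 0 → ZetaBody W p f ι ((q : ℚ) : ℝ) Λ c d₁ a A z x →
        (∀ n : ℕ, I.proj n y =
          levelToLayer W p hK hp (badPlaces c d₁ A N) n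
            (z (n + 1) (cyclotomicLevelsRat p (badPlaces c d₁ A N)).idealOne)) →
        0 < A → Int.gcd c (6 * p * A) = 1 → Int.gcd d₁ (6 * p * N) = 1 → (d₁ : ℤ) * d' ≡ 1 [ZMOD (A : ℤ)] →
        ratCuspFactor f true c d₁ a A d' ≠ 0 → perRatio ≠ 0 →
        plusPeriod f = ((perRatio : ℚ) : ℝ) * W.realPeriodRat →
      ∀ (ι' : PadicAlgCl p ≃+* ℂ)
        (κ : ZpExtension L p) (γ' : absoluteGaloisGroup L) (ΩK : ℂ) (Ωp : (unrIntegers p)ˣ) (Λf : UnrSeries p),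
        κ.IsAnticyclotomic → κ.IsTopGenerator γ' → ΩK ≠ 0 →
        IsBDPLFunction ι' (X11b.primeOfEmbeddingDatum p ι' w₀.embedding) κ γ' Dt.f ΩK
          ((Ωp : unrIntegers p) : ℂ_[p]) Λf →
      ∀ (X : ℂ_[p]), Λf.HasValueAt 0 X →
      ∀ σ : ℚ_[p], HasLocPKummerLog W p (bottomClass W p K I y) σ → σ ≠ 0 →
        ‖X‖ = (p : ℝ) ^ (bdvExplicitExponentR p (W.LFunction p) Dt.c s k (congruenceNumber Dt.f) D.modularDegree
            (σ.valuation + padicValRat p (perRatio /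
              (q * ratCuspFactor f true c d₁ a A d' * ∏ ℓ ∈ A.primeFactors.erase p, eulerFactorAtOne W N ℓ))) N -
            V p (NumberField.discr L))

/-! ## §1 Newform vocabulary: the D-twins (definitions with bodies; one posited interface `NFPort`) -/

section NF

variable (p : ℕ) [Fact p.Prime]

/-- D2e — `P_ℓ(ℓ⁻¹) = 1 − a_ℓ(g)/ℓ + ε(ℓ)/ℓ` for a weight-two form `g` of level `N` (`ε(ℓ) = 0` for `ℓ ∣ N`, else `1`):
the twin of `MemberMultiplierInputs.eulerFactorAtOne W N ℓ` with `a_ℓ(g) = cuspCoeff g ℓ` in place of `W.LFunction ℓ`.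
[cite: Kato2004Asterisque, Ex. 13.3 (p. 225), Lemma 13.10 (1) (p. 230)] -/
def eulerFactorAtOneNF {N : ℕ} (g : CuspForm (Gamma0 N) 2) (M ℓ : ℕ) : ℂ :=
  1 - cuspCoeff g ℓ / ℓ + (if ℓ ∣ M then 0 else (1 : ℂ) / ℓ)

/-- D2c — Kato's four-term auxiliary-cusp factor `R^∓_χ` (Thm. 6.6 (1), Lemma 13.10 (1); parity cross-over as in
`EulerSystemValues.cuspFactor`) for a newform `g` with ARBITRARY coefficients, the symbols read in the period currency
`(Ω⁺, Ω⁻)`: `[r]⁺ := plusSymbol g r / Ω⁺`, `[r]⁻ := minusSymbol g r / Ω⁻` (complex numbers, in `K_g` by Shimura when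
`(Ω⁺, Ω⁻)` are Shimura periods).  Twin of `cuspFactor f` / `ratCuspFactor f` (which use the RATIONAL symbols of a rational
newform). [cite: Kato2004Asterisque, Thm. 6.6 (1) (p. 163), Lemma 13.10 (1) (p. 230)] -/
def cuspFactorNF {N : ℕ} (g : CuspForm (Gamma0 N) 2) (Ωp Ωm : ℂ) (even : Bool) (χbar : ℤ → ℂ) (c d a : ℤ) (A : ℕ)
    (d' : ℤ) : ℂ :=
  let sym : ℚ → ℂ := if even then (fun r ↦ minusSymbol g r / Ωm) else (fun r ↦ plusSymbol g r / Ωp)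
  ((c : ℂ) ^ 2 * (d : ℂ) ^ 2) * sym ((a : ℚ) / A)
    - ((c : ℂ) * (d : ℂ) ^ 2) * χbar c * sym ((a * c : ℚ) / A)
    - ((c : ℂ) ^ 2 * (d : ℂ)) * χbar d * sym ((a * d' : ℚ) / A)
    + ((c : ℂ) * (d : ℂ)) * χbar (c * d) * sym ((a * c * d' : ℚ) / A)

/-- D2p — `(Ω⁺, Ω⁻)` is a pair of **`λ`-OPTIMAL periods** of `g` for the place `λ` induced by `ι′`: both non-zero, every
modular symbol of `g` is `λ`-INTEGRAL in this currency (`‖ι′⁻¹([r]^±)‖ ≤ 1`) and some symbol is a `λ`-UNIT.  This is the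
modular-symbol normalisation of the canonical periods; under `(irr_ℚ)` the Hecke algebra is Gorenstein at `𝔪_λ` and these
are BSTW's optimal periods `Ω^±` up to `O_(λ)^×` [BSTW24 §1.2.4–1.2.9: Rem. 1.1–1.2, Lemma (GorPer); identification with
Vatsal's canonical periods p.16 L102–110].  Twin of `plusPeriod f = perRatio · W.realPeriodRat`, `c Ω⁻_f = k Ω⁻_E`.
[cite: BurungaleSkinnerTianWan2024, §1.2 Rem. 1.1–1.3, p. 14] -/
def IsOptimalPeriodPair {N : ℕ} (g : CuspForm (Gamma0 N) 2) (ι' : PadicAlgCl p ≃+* ℂ) (Ωp Ωm : ℂ) : Prop :=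
  Ωp ≠ 0 ∧ Ωm ≠ 0 ∧
    (∀ r : ℚ, ‖ι'.symm (plusSymbol g r / Ωp)‖ ≤ 1 ∧ ‖ι'.symm (minusSymbol g r / Ωm)‖ ≤ 1) ∧
    (∃ r : ℚ, ‖ι'.symm (plusSymbol g r / Ωp)‖ = 1) ∧ (∃ r : ℚ, ‖ι'.symm (minusSymbol g r / Ωm)‖ = 1)

/-- The evaluation `ℚ̄_p ⊗_ℚ ℚ(ζ_m) → ℂ`, `y ⊗ ζ ↦ ι′(y) · ι_m(ζ)` (plumbing for `charSumNF`). [folklore] -/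
def evalTensor (m : ℕ) [NeZero m] (ι' : PadicAlgCl p ≃+* ℂ) (ιm : CyclotomicField m ℚ →+* ℂ) :
    PadicAlgCl p ⊗[ℚ] CyclotomicField m ℚ →ₐ[ℚ] ℂ :=
  Algebra.TensorProduct.lift (ι'.toRingHom.toRatAlgHom) ιm.toRatAlgHom (fun _ _ ↦ Commute.all _ _)

/-- Kato's character sum `Σ_{b ∈ (ℤ/m)ˣ} χ(b) · (ι′ ⊗ ι_m)((1 ⊗ σ_b) y)` of `y ∈ ℚ̄_p ⊗ ℚ(ζ_m)` — the twin of
`EulerSystemValues.charSum` for coefficient values (left side of Thm. 6.6 (1), p. 163). [folklore] -/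
def charSumNF (m : ℕ) [NeZero m] (ι' : PadicAlgCl p ≃+* ℂ) (ιm : CyclotomicField m ℚ →+* ℂ)
    (χ : DirichletCharacter ℂ m) (y : PadicAlgCl p ⊗[ℚ] CyclotomicField m ℚ) : ℂ :=
  ∑ b : (ZMod m)ˣ, χ (b : ZMod m) *
    evalTensor p m ι' ιm
      (Algebra.TensorProduct.map (AlgHom.id ℚ (PadicAlgCl p))
        (sigma m b : CyclotomicField m ℚ →ₐ[ℚ] CyclotomicField m ℚ) y)

/-- **D2 — `ZetaBodyNF`: the matrix of Kato's Example 13.3 / (8.1.3) for the `ℚ̄_p`-representation `ρ` of a newform `g`**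
— `EulerSystemValues.ZetaBody` transcribed clause by clause with `T := ρ.toGaloisRep` (in the intended use
`IsGaloisRepOfNewform1 (liftToGamma1 N 2 g) ι_λ {ℓ ∣ Np} ρ`) in place of `tateRep W p`, the value datum
`Λ_{k,r} : H¹(ℚ(μ_m), T) → ℚ̄_p ⊗_ℚ ℚ(ζ_m)` (`exp*` read in the coordinate of the GOOD differential `ω_g/c̃_g`, `c̃_g` the
datum's `congrIdx` — rev 1.2 §H pinning `a = 0`: the pinned bottom class is then `κ·𝐳_{γ_g}`, `γ_g = δ_g/c̃_g` BSTW's `O`-basis;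
PORT TOGETHER with `NFPort.HasBKLog` (`b = 0`) and `NFPort.IsCongruenceGenerator` — §H (H5) N3), the complex constant `κ`, the periods
`(Ω⁺, Ω⁻)` as PARAMETERS (pinned by `IsOptimalPeriodPair` in the consumer), classes `z_{k,r}` and values
`x_{k,r} ∈ ℚ̄_p ⊗ ℚ(ζ_m)`: (C1) Euler system on all levels; (C2) unramified away from `p`; (C3a) `Gal(ℚ(μ_m)/ℚ)`-equivariance
of `Λ`; (C3b) `Λ` local at `p`; (C4) `Λ_{k,r}(z_{k,r}) = x_{k,r}` (Kato's rationality `x ∈ K_g(ζ_m)`, Thm. 9.7, is NOT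
re-imposed here — port may add it through `coeffCharField`); (C5) the value law of Thm. 9.7 ∘ Thm. 6.6 (1):
`Σ_b χ(b)(ι′⊗ι_m)(σ_b x_{k,r}) = κ · L_S(g,χ,1)/Ω⁺ · R⁻_χ` (`χ` even), `= −κ · L_S(g,χ,1)/Ω⁻ · R⁺_χ` (`χ` odd; the curve
side's `i·Ω⁻_f` is absorbed in `Ω⁻`).  A PREDICATE (parameters explicit, no `∃`); nothing asserted.
[cite: Kato2004Asterisque, (8.1.3) (p. 180), Prop. 8.12 (p. 186), Thm. 9.7 (p. 189), Thm. 6.6 (1) (p. 163), Thm. 12.5 (p. 229), Ex. 13.3 (pp. 224–225)]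
[cite: Rubin2000, Def. 2.1.1 and Remark 2.1.4] -/
def ZetaBodyNF (ρ : FramedGaloisRep ℚ (PadicAlgCl p) 2) {N : ℕ} (g : CuspForm (Gamma0 N) 2)
    (ι' : PadicAlgCl p ≃+* ℂ) (ι : (m : ℕ) → (CyclotomicField m ℚ →+* ℂ)) (κ Ωp Ωm : ℂ)
    (Λ : ∀ (k : ℕ) (r : Finset (HeightOneSpectrum (𝓞 ℚ))),
      H1 ρ.toGaloisRep (cycSubgroup p k r) →ₗ[PadicAlgCl p]
        PadicAlgCl p ⊗[ℚ] CyclotomicField (cycLevel p k r) ℚ)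
    (c d a : ℤ) (A : ℕ)
    (z : ∀ (k : ℕ) (r : (cyclotomicLevelsRat p (badPlaces c d A N)).Ideals),
      H1 ρ.toGaloisRep ((cyclotomicLevelsRat p (badPlaces c d A N)).level k r.1))
    (x : ∀ (k : ℕ) (r : (cyclotomicLevelsRat p (badPlaces c d A N)).Ideals),
      PadicAlgCl p ⊗[ℚ] CyclotomicField (cycLevel p k r.1) ℚ) : Prop :=
  let T := ρ.toGaloisRep
  let L := cyclotomicLevelsRat p (badPlaces c d A N)
  -- (C1) Euler system, ALL levels
  IsEulerSystem L T p z ∧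
  -- (C2) unramified away from `p`, class level
  (∀ (k : ℕ) (r : L.Ideals) (v : HeightOneSpectrum (𝓞 ℚ)), ((primesEquiv v : Nat.Primes) : ℕ) ≠ p →
      ∀ 𝔓 ∈ v.primesAbove,
        resLe T.toTopRep
            (inf_le_left : L.level k r.1 ⊓ 𝔓.inertia (absoluteGaloisGroup ℚ) ≤ L.level k r.1)
            1 (z k r) = 0) ∧
  -- (C3a) `Gal(ℚ(μ_m)/ℚ)`-equivariance of `Λ`
  (∀ (k : ℕ) (r : Finset (HeightOneSpectrum (𝓞 ℚ))) (σ : absoluteGaloisGroup ℚ)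
      (y : H1 T (cycSubgroup p k r)),
      Λ k r (conjMap T.toTopRep (cycSubgroup p k r) σ 1 y) =
        Algebra.TensorProduct.map (AlgHom.id ℚ (PadicAlgCl p))
          (sigma (cycLevel p k r) (modNCyclotomicCharacter ℚ (cycLevel p k r) σ) :
            CyclotomicField (cycLevel p k r) ℚ →ₐ[ℚ] CyclotomicField (cycLevel p k r) ℚ)
          (Λ k r y)) ∧
  -- (C3b) `Λ` is LOCAL AT `p`
  (∀ (k : ℕ) (r : Finset (HeightOneSpectrum (𝓞 ℚ))) (y : H1 T (cycSubgroup p k r)),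
      (∀ v : HeightOneSpectrum (𝓞 ℚ), ((primesEquiv v : Nat.Primes) : ℕ) = p →
        ∀ 𝔓 ∈ v.primesAbove,
          resLe T.toTopRep
              (inf_le_left : cycSubgroup p k r ⊓ MulAction.stabilizer (absoluteGaloisGroup ℚ) 𝔓 ≤
                cycSubgroup p k r)
              1 y = 0) →
      Λ k r y = 0) ∧
  -- (C4) the declared coordinate
  (∀ (k : ℕ) (r : L.Ideals), Λ k r.1 (z k r) = x k r) ∧
  -- (C5) value law, `S = prime(m·p·A)`, in `(Ω⁺, Ω⁻)`-currency
  (∀ (k : ℕ) (r : L.Ideals) (d' : ℤ) (χ : DirichletCharacter ℂ (cycLevel p k r.1)) (Lχ : ℂ → ℂ),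
      Int.gcd (c * d) (cycLevel p k r.1 * A) = 1 →
      d * d' ≡ 1 [ZMOD (A : ℤ)] →
      IsDepletedTwistedL g (cycLevel p k r.1) (p * A) χ Lχ →
        (χ (-1) = 1 →
          charSumNF p (cycLevel p k r.1) ι' (ι (cycLevel p k r.1)) χ (x k r) =
            κ * (Lχ 1 / Ωp) *
              cuspFactorNF g Ωp Ωm true (fun n ↦ χ⁻¹ (n : ZMod (cycLevel p k r.1))) c d a A d') ∧
        (χ (-1) = -1 →
          charSumNF p (cycLevel p k r.1) ι' (ι (cycLevel p k r.1)) χ (x k r) =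
            -κ * (Lχ 1 / Ωm) *
              cuspFactorNF g Ωp Ωm false (fun n ↦ χ⁻¹ (n : ZMod (cycLevel p k r.1))) c d a A d'))

end NF

/-- **D3 — the posited INTERFACE** (rev 1.2: TWO fields).  `HasBKLog p g ι′ ρ x t` reads «`t ∈ ℚ̄_p` is the Bloch–Kato
logarithm `log_BK^{η_{ω_g}}(loc_𝔭 x)` of the class `x ∈ H¹(F, ρ)` (any level `F = ℚ̄^U`) at the prime `𝔭 ∣ p` of `ℚ̄` fixed by
the frame, ALONG THE FIXED NEWFORM DIFFERENTIAL `ω_g ↔ 2πi·g(z)dz`» exactly as printed in (log-Kato-elt-1) [BSTW24 p.60 L36–44;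
`η_ω`: p.17 L69–70] — rev 1.2 §H pinning `b = 0` (rev 1.1 said «for SOME good `ω`», which is `b = 1`); «along `η`» MEANS the
`η_{ω_g}`-coordinate of `log_BK` modulo `Fil⁰` (≡ `±[log_BK ·, ω_g]`; §H (H5) N2), and the three pinning docstrings (`ZetaBodyNF`, this
field, `IsCongruenceGenerator`) are ONE declaration to be PORTED TOGETHER (§H (H5) N3).
`IsCongruenceGenerator p g ι′ t` reads «`t ∈ ℚ̄_p` generates, over `O_λ`, BSTW's `Γ₁(N)`-congruence ideal of `g`:
`t·O_λ = φ_{Γ₁(N),O}(Ann_𝕋(𝔭_g))·O_λ`» [BSTW24 (congruence), (cong-formula) p.15 L43–56] — the NF chain's OWN INDEX `c̃_g` (§H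
(H2)); the general notion (ARS12 §3) is not in the tree, hence posited like `HasBKLog` [§1.2.10–1.2.12, p. 16–18].  The tree
types this for the Tate module of a curve only (`HasLocPKummerLog`, formal group); for `V_g(1)` it needs `D_dR`/`exp_BK`,
absent today — hence an interface, consumed as a PARAMETER `(P : NFPort)` by every statement of the sibling module
`ErratumRoadFiveBdvCalibrationSplitNFCalibratorDefs`, with the construction
of the intended instance a separate port obligation (never an `instance`, never an axiom).
[cite: BurungaleSkinnerTianWan2024, §1.2.10–1.2.12, p. 16–18] [cite: BlochKato1990, Def. 3.10] -/
structure NFPort where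
  /-- «`t = log_BK^{η_{ω_g}}(loc_𝔭 x)` along the FIXED `ω_g`» (rev 1.2; was «for some good `ω`») — see the structure docstring. -/
  HasBKLog : ∀ (p : ℕ) [Fact p.Prime] {N : ℕ} (_g : CuspForm (Gamma0 N) 2) (_ι' : PadicAlgCl p ≃+* ℂ)
    (ρ : FramedGaloisRep ℚ (PadicAlgCl p) 2) {U : Subgroup (absoluteGaloisGroup ℚ)},
    H1 ρ.toGaloisRep U → PadicAlgCl p → Prop
  /-- «`t·O_λ` is BSTW's `Γ₁(N)`-congruence ideal of `g`» (the NF chain's own index `c̃_g`, rev 1.2 §H (H2)). -/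
  IsCongruenceGenerator : ∀ (p : ℕ) [Fact p.Prime] {N : ℕ} (_g : CuspForm (Gamma0 N) 2) (_ι' : PadicAlgCl p ≃+* ℂ),
    PadicAlgCl p → Prop

end Summit.BirchSwinnertonDyer.BirchSwinnertonDyer.Theorems.ErratumRoadFiveBdvCalibrationSplitNF

end
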